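import Literature.Computability.FineGrained.EditDistOVProgram
import Literature.Computability.FineGrained.LCSFromOVRun
import Literature.Computability.FineGrained.BKGadgetProofs
import HarnessLib

/-!
# OV → binary edit distance on the word RAM, III: the bits written are `ovX I`, `ovY I`; the whole program and its run

**Part 1 (the bridge).** The Boolean position arithmetic of the reduction program
(`EDRed.xBit₃`, `EDRed.yBit₆` of `Literature.Computability.FineGrained.EditDistOVProgram`) computes
the strings of Bringmann–Künnemann's OV → EDIT reduction (`BKReduction.ovX`, `BKReduction.ovY` of
`Literature.Computability.FineGrained.EditDistanceOVGadgets`): `EDRed.xBit₃_eq` and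
`EDRed.yBit₆_eq`, level by level through `BKGadget.Params.getD_gadgetX/getD_gadgetY`
(`EditDistOVBits`) and `EDRed.blockBit_eq_edBit` (the ten ranges of an alignment-gadget period are
the arithmetic dispatch `EDRed.edBit` of the program); and `LX = |ovX I|`, `LY = |ovY I|`.

**Part 2 (the run).** The complete reduction program on the word RAM with an edit-distance oracle
(`WordRAM.Program` with one `query`), and its run on the encoding of an OV instance `I`:

* `EDRed.geo I`: the geometry of the run on `OV.encode I` (`D = |OV.encode I| + 100`);
* `EDRed.prog` = `relocate; setup₁; if n = 0 then output [0] else main`,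
  `main = setupMain; loopX; loopY; query Q LEN ANS; post` — `post` reads the oracle's answer
  `δ = editDist x y` and outputs `[δ < ρ + 1]`, i.e. `[δ(x, y) ≤ ρ]`;
* `EDRed.readSeg_dataQ`: the query is `encodeBoolPair (ovX I, ovY I) = EditDistance.encode (ovX I, ovY I)`;
* `EDRed.rho_eq`: the program's threshold is `BKReduction.ovThreshold I`;
* **`EDRed.prog_exec`**: for every oracle answering `EditDistance`, `prog` executes on
  `OV.encode I` within `EDRed.Ttot I` steps to a store with read-out `[1]` iff `I` has an
  orthogonal pair (`[0]` otherwise) — by `BKReduction.editDist_ovX_ovY_le_iff` with BK15 Lemma 5.4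
  proved (`alignmentGadget_editDist_holds` of `BKGadgetProofs`) — and query log
  `[EditDistance.encode (ovX I, ovY I)]` (empty if `n = 0`), provided the word size holds the
  input width and `(geo I).BND`.

[cite: BringmannKunnemannFOCS2015, Thm. 3.3 (proof, §3.1) with Lemmas 5.2–5.4]
[cite: BackursIndykSTOC2015, Thm. 1 (architecture)]
-/

namespace Literature.Computability.FineGrained.EDRed

open Cryptography Cryptography.WordRAM BKGadget BKReduction LCSRed

/-! ### `blockBit` versus `edBit` -/

/-- Reduction modulo `2γ` below `4γ`. [folklore] -/
theorem mod_add_self_lt_iff {γ s : ℕ} (hs : s < γ + γ + (γ + γ)) :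
    s % (γ + γ) < γ ↔ s < γ ∨ (γ + γ ≤ s ∧ s < γ + γ + γ) := by
  rcases lt_or_ge s (γ + γ) with h | h
  · rw [Nat.mod_eq_of_lt h]; omega
  · rw [Nat.mod_eq_sub_mod h, Nat.mod_eq_of_lt (by omega)]; omega

/-- [folklore] -/
theorem true_eq_decide_iff {p : Prop} [Decidable p] : (true = decide p) ↔ p := by
  by_cases hp : p <;> simp [hp]

/-- [folklore] -/
theorem false_eq_decide_iff {p : Prop} [Decidable p] : (false = decide p) ↔ ¬ p := by
  by_cases hp : p <;> simp [hp]

/-- [folklore] -/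
theorem true_eq_not_decide_iff {p : Prop} [Decidable p] : (true = !decide p) ↔ ¬ p := by
  by_cases hp : p <;> simp [hp]

/-- [folklore] -/
theorem false_eq_not_decide_iff {p : Prop} [Decidable p] : (false = !decide p) ↔ p := by
  by_cases hp : p <;> simp [hp]

/-- **The ten ranges of a period are the arithmetic dispatch of the program**: for any inner bit
function agreeing with the block on its range, `blockBit` is `edBit` with the values
`γ₁, 2γ₁, 4γ₁, 4γ₁ + ℓ, 8γ₁ + ℓ` (written as the sums the program computes). [folklore] -/
theorem blockBit_eq_edBit (P : BKGadget.Params) (ℓ : ℕ) (z : List Bool) (zb : ℕ → Bool)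
    (h : ∀ q, q < ℓ → z.getD q false = zb q) (r : ℕ) :
    P.blockBit ℓ z r =
      edBit P.γ₁ (P.γ₁ + P.γ₁) (P.γ₁ + P.γ₁ + (P.γ₁ + P.γ₁)) (P.γ₁ + P.γ₁ + (P.γ₁ + P.γ₁) + ℓ)
        (P.γ₁ + P.γ₁ + (P.γ₁ + P.γ₁) + ℓ + (P.γ₁ + P.γ₁ + (P.γ₁ + P.γ₁))) zb r := by
  set F := P.γ₁ + P.γ₁ + (P.γ₁ + P.γ₁) with hF
  unfold BKGadget.Params.blockBit edBit
  by_cases c1 : r < P.γ₁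
  · rw [if_pos c1, if_pos (show r < F by omega), true_eq_decide_iff,
      Nat.mod_eq_of_lt (show r < P.γ₁ + P.γ₁ by omega)]; exact c1
  rw [if_neg c1]
  by_cases c2 : r < 2 * P.γ₁
  · rw [if_pos c2, if_pos (show r < F by omega), false_eq_decide_iff,
      Nat.mod_eq_of_lt (show r < P.γ₁ + P.γ₁ by omega)]; omega
  rw [if_neg c2]
  by_cases c3 : r < 3 * P.γ₁
  · rw [if_pos c3, if_pos (show r < F by omega), true_eq_decide_iff,
      Nat.mod_eq_sub_mod (show r ≥ P.γ₁ + P.γ₁ by omega),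
      Nat.mod_eq_of_lt (show r - (P.γ₁ + P.γ₁) < P.γ₁ + P.γ₁ by omega)]; omega
  rw [if_neg c3]
  by_cases c4 : r < 4 * P.γ₁
  · rw [if_pos c4, if_pos (show r < F by omega), false_eq_decide_iff,
      Nat.mod_eq_sub_mod (show r ≥ P.γ₁ + P.γ₁ by omega),
      Nat.mod_eq_of_lt (show r - (P.γ₁ + P.γ₁) < P.γ₁ + P.γ₁ by omega)]; omega
  rw [if_neg c4, if_neg (show ¬ r < F by omega)]
  by_cases c5 : r < 4 * P.γ₁ + ℓ
  · rw [if_pos c5, if_pos (show r < F + ℓ by omega), h _ (show r - 4 * P.γ₁ < ℓ by omega)]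
    congr 1; omega
  rw [if_neg c5, if_neg (show ¬ r < F + ℓ by omega)]
  by_cases c6 : r < 5 * P.γ₁ + ℓ
  · rw [if_pos c6, if_pos (show r < F + ℓ + F by omega), false_eq_not_decide_iff,
      Nat.mod_eq_of_lt (show r - (F + ℓ) < P.γ₁ + P.γ₁ by omega)]; omega
  rw [if_neg c6]
  by_cases c7 : r < 6 * P.γ₁ + ℓ
  · rw [if_pos c7, if_pos (show r < F + ℓ + F by omega), true_eq_not_decide_iff,
      Nat.mod_eq_of_lt (show r - (F + ℓ) < P.γ₁ + P.γ₁ by omega)]; omega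
  rw [if_neg c7]
  by_cases c8 : r < 7 * P.γ₁ + ℓ
  · rw [if_pos c8, if_pos (show r < F + ℓ + F by omega), false_eq_not_decide_iff,
      Nat.mod_eq_sub_mod (show r - (F + ℓ) ≥ P.γ₁ + P.γ₁ by omega),
      Nat.mod_eq_of_lt (show r - (F + ℓ) - (P.γ₁ + P.γ₁) < P.γ₁ + P.γ₁ by omega)]; omega
  rw [if_neg c8]
  by_cases c9 : r < 8 * P.γ₁ + ℓ
  · rw [if_pos c9, if_pos (show r < F + ℓ + F by omega), true_eq_not_decide_iff,
      Nat.mod_eq_sub_mod (show r - (F + ℓ) ≥ P.γ₁ + P.γ₁ by omega),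
      Nat.mod_eq_of_lt (show r - (F + ℓ) - (P.γ₁ + P.γ₁) < P.γ₁ + P.γ₁ by omega)]; omega
  rw [if_neg c9, if_neg (show ¬ r < F + ℓ + F by omega)]

/-- The level-1 instance: the period of a coordinate word (`γ₁ = 200`). [folklore] -/
theorem blockBit_P₁ (w : List Bool) (zb : ℕ → Bool) (h : ∀ t, t < 5 → w.getD t false = zb t) (r : ℕ) :
    P₁.blockBit 5 w r = edBit 200 400 800 805 1605 zb r := by
  have := blockBit_eq_edBit P₁ 5 w zb h r
  rw [P₁_γ₁] at this
  norm_num at this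
  exact this

/-! ### The `x` side -/

section bridge

variable (g : Geo) (I : OVInstance) (hg : g.n = I.n ∧ g.d = I.d)
include hg

/-- Bits of a level-1 string `P₁.gadgetX (CG₀, …, CG_d)` by coordinate and bit index. [folklore] -/
theorem getD_gadgetX_P₁ (cg : Fin (I.d + 1) → List Bool) (hcg : ∀ k, (cg k).length = 5) (q : ℕ)
    (hq : q < g.q₂.ℓx) :
    (P₁.gadgetX (List.ofFn cg)).getD q false =
      P₁.blockBit 5 (cg ⟨q / 4015, (Nat.div_lt_iff_lt_mul (by decide)).2 (by rw [g.q₂_ℓx, hg.2] at hq; omega)⟩)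
        (q % 4015) := by
  have hℓ : g.q₂.ℓx = I.d * 4015 + 1605 := by rw [g.q₂_ℓx, hg.2]
  have hkd : q / 4015 < I.d + 1 := (Nat.div_lt_iff_lt_mul (by decide)).2 (by omega)
  have hlen : (P₁.gadgetX (List.ofFn cg)).length = (I.d + 1) * 1605 + I.d * 2410 := by
    rw [P₁.length_gadgetX (ℓ := 5) _ (by simp [List.mem_ofFn', hcg]), List.length_ofFn, P₁_γ₂, P₁_γ₁]
    omega
  rw [P₁.getD_gadgetX (ℓ := 5) (by decide) _ (by simp [List.mem_ofFn', hcg]) q (by rw [hlen]; omega), P₁_perOf,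
    List.getD_eq_getElem _ _ (by simpa using hkd), List.getElem_ofFn]

/-- Level 1 (`x` side): bits of `VG(a_{i₃ mod n})` (`sel = 1`) / `S` (`sel = 0`) are `xBit₁`. [folklore] -/
theorem getD_vg_eq_xBit₁ (hn : 0 < I.n) (i₃ sel : ℕ) (hsel : sel ≤ 1) (q : ℕ) (hq : q < g.q₂.ℓx) :
    ((if sel = 1 then vgX (I.A ⟨i₃ % I.n, Nat.mod_lt _ hn⟩) else vgS I.d).getD q false) =
      xBit₁ I hn i₃ sel q := by
  have hkd : q / 4015 < I.d + 1 := (Nat.div_lt_iff_lt_mul (by decide)).2 (by rw [g.q₂_ℓx, hg.2] at hq; omega)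
  unfold xBit₁
  rcases Nat.le_one_iff_eq_zero_or_eq_one.1 hsel with rfl | rfl
  · rw [if_neg zero_ne_one]
    unfold vgS
    rw [getD_gadgetX_P₁ g I hg (cgS I.d) (length_cgS I.d) q hq]
    exact blockBit_P₁ _ _ (fun t ht => by
      simpa using getD_xCoord I hn i₃ 0 (q / 4015) hkd (by decide) t ht) _
  · rw [if_pos rfl]
    unfold vgX
    rw [getD_gadgetX_P₁ g I hg (cgX _) (length_cgX _) q hq]
    exact blockBit_P₁ _ _ (fun t ht => by
      simpa using getD_xCoord I hn i₃ 1 (q / 4015) hkd le_rfl t ht) _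

omit hg in
/-- The level-2 period in the program's form. [folklore] -/
theorem per₂_eq : g.per₂ = g.q₂.perOf g.q₂.ℓx := by
  unfold Geo.per₂ Geo.G₂x Geo.F₂ BKGadget.Params.perOf; omega

/-- Level 2 (`x` side): bits of `NVG(a_{i₃ mod n})` are `xBit₂`. [folklore] -/
theorem getD_nvgX_eq_xBit₂ (hn : 0 < I.n) (i₃ q : ℕ) (hq : q < g.q₃.ℓx) :
    (nvgX (I.A ⟨i₃ % I.n, Nat.mod_lt _ hn⟩)).getD q false = xBit₂ g I hn i₃ q := by
  obtain ⟨hgn, hgd⟩ := hg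
  have hq₂ : g.q₂ = P₂ I.d := by rw [Geo.q₂, hgd]
  have hℓ₃ : g.q₃.ℓx = g.q₂.perOf g.q₂.ℓx + (8 * g.q₂.γ₁ + g.q₂.ℓx) := by
    rw [g.q₃_ℓx]; unfold BKGadget.Params.perOf; omega
  have hpos : 0 < g.q₂.ℓx := by rw [g.q₂_ℓx]; omega
  have hper0 : 0 < g.q₂.perOf g.q₂.ℓx := g.q₂.perOf_pos hpos
  have hsel : q / g.q₂.perOf g.q₂.ℓx ≤ 1 := by
    have : q / g.q₂.perOf g.q₂.ℓx < 2 := (Nat.div_lt_iff_lt_mul hper0).2 (by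
      unfold BKGadget.Params.perOf at hℓ₃ ⊢; omega)
    omega
  unfold xBit₂
  rw [per₂_eq g]
  unfold nvgX
  rw [ofFn_pairSX, ← hq₂]
  have hlen2 : ∀ z ∈ [vgS I.d, vgX (I.A ⟨i₃ % I.n, Nat.mod_lt _ hn⟩)], z.length = g.q₂.ℓx := by
    intro z hz
    simp only [List.mem_cons, List.not_mem_nil, or_false] at hz
    rcases hz with rfl | rfl
    · rw [length_vgS, hq₂]; rfl
    · rw [length_vgX, hq₂]; rfl
  have hlenN : (g.q₂.gadgetX [vgS I.d, vgX (I.A ⟨i₃ % I.n, Nat.mod_lt _ hn⟩)]).length = g.q₃.ℓx := by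
    rw [g.q₂.length_gadgetX _ hlen2, g.q₃_ℓx]; simp
  rw [g.q₂.getD_gadgetX hpos _ hlen2 q (by rw [hlenN]; exact hq)]
  unfold Geo.G₂x Geo.F₂
  refine blockBit_eq_edBit _ _ _ _ (fun q' hq' => ?_) _
  rcases Nat.le_one_iff_eq_zero_or_eq_one.1 hsel with h0 | h1
  · rw [h0]
    simpa using getD_vg_eq_xBit₁ g I ⟨hgn, hgd⟩ hn i₃ 0 (by decide) q' hq'
  · rw [h1]
    simpa using getD_vg_eq_xBit₁ g I ⟨hgn, hgd⟩ hn i₃ 1 le_rfl q' hq'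

omit hg in
/-- The level-3 period in the program's form. [folklore] -/
theorem per₃_eq : g.per₃ = g.q₃.perOf g.q₃.ℓx := by
  unfold Geo.per₃ Geo.G₃ Geo.F₃ BKGadget.Params.perOf; omega

/-- `|ovX I| = LX`. [folklore] -/
theorem length_ovX_eq (hn : 0 < I.n) : (ovX I).length = g.LX := by
  rw [length_ovX]
  unfold Geo.LX Geo.G₃ Geo.F₃
  rw [Geo.q₃, hg.1, hg.2]
  have : 1 ≤ 2 * I.n := by omega
  zify [this, show 1 ≤ I.n + I.n by omega]
  ring

/-- **Level 3 (`x` side): the `x` loop writes the bits of `ovX I`.** [folklore] -/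
theorem xBit₃_eq (hn : 0 < I.n) (p : ℕ) (hp : p < (ovX I).length) :
    xBit₃ g I hn p = (ovX I).getD p false := by
  obtain ⟨hgn, hgd⟩ := hg
  have hq₃ : g.q₃ = P₃ I.d := by rw [Geo.q₃, hgd]
  have hpos : 0 < g.q₃.ℓx := by rw [g.q₃_ℓx, g.q₂_ℓx]; omega
  have hper0 : 0 < g.q₃.perOf g.q₃.ℓx := g.q₃.perOf_pos hpos
  have hlen3 : ∀ z ∈ List.ofFn (xs I), z.length = g.q₃.ℓx := by
    intro z hz
    obtain ⟨i, rfl⟩ := (List.mem_ofFn' _ _).1 hz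
    unfold xs; rw [length_nvgX, hq₃]; rfl
  have hLX := length_ovX_eq g I ⟨hgn, hgd⟩ hn
  have hi : p / g.q₃.perOf g.q₃.ℓx < 2 * I.n := by
    refine (Nat.div_lt_iff_lt_mul hper0).2 ?_
    rw [hLX] at hp
    have e : 2 * I.n * g.q₃.perOf g.q₃.ℓx = g.LX + g.q₃.γ₂ := by
      unfold Geo.LX Geo.G₃ Geo.F₃ BKGadget.Params.perOf
      rw [hgn]
      obtain ⟨k, hk⟩ : ∃ k, I.n + I.n = k + 1 := ⟨I.n + I.n - 1, by omega⟩
      rw [show 2 * I.n = I.n + I.n by ring, hk, Nat.add_sub_cancel]; ring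
    rw [e]; omega
  unfold xBit₃
  rw [per₃_eq g]
  symm
  unfold ovX
  rw [← hq₃, g.q₃.getD_gadgetX hpos _ hlen3 p (by unfold ovX at hp; rwa [← hq₃] at hp),
    List.getD_eq_getElem _ _ (by simpa using hi), List.getElem_ofFn]
  unfold xs Geo.G₃ Geo.F₃
  exact blockBit_eq_edBit _ _ _ _ (fun q hq => getD_nvgX_eq_xBit₂ g I ⟨hgn, hgd⟩ hn _ q hq) _

/-! ### The `y` side -/

/-- Level 1 (`y` side): bits of the core of `VG(b_j)` are `yBit₁`. [folklore] -/
theorem getD_coreY_eq_yBit₁ (j : Fin I.n) (q : ℕ) (hq : q < g.q₂.ℓx) :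
    (P₁.gadgetX (List.ofFn (cgY (I.B j)))).getD q false = yBit₁ I j q := by
  have hkd : q / 4015 < I.d + 1 := (Nat.div_lt_iff_lt_mul (by decide)).2 (by rw [g.q₂_ℓx, hg.2] at hq; omega)
  unfold yBit₁
  rw [getD_gadgetX_P₁ g I hg (cgY _) (length_cgY _) q hq]
  exact blockBit_P₁ _ _ (fun t ht => getD_yCoord I j (q / 4015) hkd t ht) _

/-- Level 2 (`y` side): bits of `VG(b_j) = 0^{4820(d+1)} core 0^{4820(d+1)}` are `yBit₂`. [folklore] -/
theorem getD_vgY_eq_yBit₂ (j : Fin I.n) (q : ℕ) : (vgY (I.B j)).getD q false = yBit₂ g I j q := by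
  have hlen : (P₁.gadgetX (List.ofFn (cgY (I.B j)))).length = g.q₂.ℓx := by
    rw [P₁.length_gadgetX (ℓ := 5) _ (by simp [List.mem_ofFn', length_cgY]), List.length_ofFn, P₁_γ₂, P₁_γ₁,
      g.q₂_ℓx, hg.2, Nat.add_sub_cancel]
    ring
  unfold vgY yBit₂ threeBit
  rw [P₁.getD_gadgetY, P₁_γ₃, hlen]
  have e : (I.d + 1) * 4820 = g.pad₁ := by unfold Geo.pad₁; rw [hg.2]; ring
  rw [e]
  by_cases h1 : q < g.pad₁
  · rw [if_pos h1, if_pos h1]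
  rw [if_neg h1, if_neg h1]
  by_cases h2 : q - g.pad₁ < g.q₂.ℓx
  · rw [if_pos h2, if_pos (by omega), getD_coreY_eq_yBit₁ g I hg j _ h2]
  · rw [if_neg h2, if_neg (by omega)]

/-- Level 3 (`y` side): bits of `G'(VG(b_j))` are `yBit₃`. [folklore] -/
theorem getD_guard_vgY_eq_yBit₃ (j : Fin I.n) (q : ℕ) (hq : q < (g.q₂.guard (vgY (I.B j))).length) :
    (g.q₂.guard (vgY (I.B j))).getD q false = yBit₃ g I j q := by
  have hq₂ : g.q₂ = P₂ I.d := by rw [Geo.q₂, hg.2]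
  have hz : (vgY (I.B j)).length = g.q₂.ℓy := by rw [length_vgY, hq₂]; rfl
  unfold yBit₃ Geo.G₂y Geo.F₂
  rw [g.q₂.getD_guard hz hq]
  exact blockBit_eq_edBit _ _ _ _ (fun q' _ => getD_vgY_eq_yBit₂ g I hg j q') _

/-- Level 4 (`y` side): bits of `NVG(b_j) = 0^{2γ₃'} G'(VG(b_j)) 0^{2γ₃'}` are `yBit₄`. [folklore] -/
theorem getD_nvgY_eq_yBit₄ (j : Fin I.n) (q : ℕ) : (nvgY (I.B j)).getD q false = yBit₄ g I j q := by
  have hq₂ : g.q₂ = P₂ I.d := by rw [Geo.q₂, hg.2]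
  have hz : (vgY (I.B j)).length = g.q₂.ℓy := by rw [length_vgY, hq₂]; rfl
  have hG : (g.q₂.gadgetX [vgY (I.B j)]).length = g.G₂y := by
    rw [BKGadget.Params.gadgetX_singleton, BKGadget.Params.length_guard, hz]
    unfold Geo.G₂y Geo.F₂; omega
  unfold nvgY yBit₄ threeBit
  rw [ofFn_singleY, ← hq₂, g.q₂.getD_gadgetY, hG]
  have e : 2 * g.q₂.γ₃ = g.pad₂ := by unfold Geo.pad₂; rw [g.q₂_γ₃]; ring
  rw [e]
  by_cases h1 : q < g.pad₂
  · rw [if_pos h1, if_pos h1]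
  rw [if_neg h1, if_neg h1]
  by_cases h2 : q - g.pad₂ < g.G₂y
  · rw [if_pos h2, if_pos (by omega), BKGadget.Params.gadgetX_singleton]
    exact getD_guard_vgY_eq_yBit₃ g I hg j _ (by rw [BKGadget.Params.length_guard, hz]; unfold Geo.G₂y Geo.F₂ at h2; omega)
  · rw [if_neg h2, if_neg (by omega)]

omit hg in
/-- The level-3 period of the core of `y` in the program's form. [folklore] -/
theorem per₃y_eq : g.per₃y = g.q₃.perOf g.q₃.ℓy := by
  unfold Geo.per₃y Geo.G₃y Geo.F₃ BKGadget.Params.perOf; omega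

/-- The core of `y` has length `LC`. [folklore] -/
theorem length_coreY_eq : (g.q₃.gadgetX (List.ofFn (ys I))).length = g.LC := by
  have hq₃ : g.q₃ = P₃ I.d := by rw [Geo.q₃, hg.2]
  have hlen3 : ∀ z ∈ List.ofFn (ys I), z.length = g.q₃.ℓy := by
    intro z hz
    obtain ⟨j, rfl⟩ := (List.mem_ofFn' _ _).1 hz
    unfold ys; rw [length_nvgY, hq₃]; rfl
  rw [g.q₃.length_gadgetX _ hlen3, List.length_ofFn]
  unfold Geo.LC Geo.G₃y Geo.F₃
  rw [hg.1]
  ring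

/-- `|ovY I| = LY`. [folklore] -/
theorem length_ovY_eq : (ovY I).length = g.LY := by
  have hq₃ : g.q₃ = P₃ I.d := by rw [Geo.q₃, hg.2]
  have hlen3 : ∀ z ∈ List.ofFn (ys I), z.length = g.q₃.ℓy := by
    intro z hz
    obtain ⟨j, rfl⟩ := (List.mem_ofFn' _ _).1 hz
    unfold ys; rw [length_nvgY, hq₃]; rfl
  unfold ovY
  rw [← hq₃, g.q₃.length_gadgetY (ℓ := g.q₃.ℓy) _ _ hlen3, List.length_ofFn]
  unfold Geo.LY Geo.NP Geo.LC Geo.G₃y Geo.F₃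
  rw [hg.1]; ring

/-- Level 5 (`y` side): bits of the core of `y` are `yBit₅`. [folklore] -/
theorem getD_coreY_eq_yBit₅ (hn : 0 < I.n) (q : ℕ) (hq : q < g.LC) :
    (g.q₃.gadgetX (List.ofFn (ys I))).getD q false = yBit₅ g I q := by
  have hq₃ : g.q₃ = P₃ I.d := by rw [Geo.q₃, hg.2]
  have hlen3 : ∀ z ∈ List.ofFn (ys I), z.length = g.q₃.ℓy := by
    intro z hz
    obtain ⟨j, rfl⟩ := (List.mem_ofFn' _ _).1 hz
    unfold ys; rw [length_nvgY, hq₃]; rfl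
  have hpos : 0 < g.q₃.ℓy := by rw [g.q₃_ℓy, g.q₂_ℓy, g.q₂_ℓx]; omega
  have hper0 : 0 < g.q₃.perOf g.q₃.ℓy := g.q₃.perOf_pos hpos
  have hLC := length_coreY_eq g I hg
  have hj : q / g.q₃.perOf g.q₃.ℓy < I.n := by
    refine (Nat.div_lt_iff_lt_mul hper0).2 ?_
    rw [← hg.1]
    have hn' : 1 ≤ g.n := by rw [hg.1]; exact hn
    have e1 : g.n * g.q₃.perOf g.q₃.ℓy = g.LC + g.q₃.γ₂ := by
      unfold Geo.LC Geo.G₃y Geo.F₃ BKGadget.Params.perOf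
      obtain ⟨k, hk⟩ : ∃ k, g.n = k + 1 := ⟨g.n - 1, by omega⟩
      rw [hk, Nat.add_sub_cancel]; ring
    rw [e1]; omega
  unfold yBit₅
  rw [per₃y_eq g, g.q₃.getD_gadgetX hpos _ hlen3 q (by rw [hLC]; exact hq),
    List.getD_eq_getElem _ _ (by simpa using hj), List.getElem_ofFn]
  unfold ys Geo.G₃y Geo.F₃
  exact blockBit_eq_edBit _ _ _ _ (fun q' _ => getD_nvgY_eq_yBit₄ g I hg _ q') _

/-- **Level 6 (`y` side): the `y` loop writes the bits of `ovY I`.** [folklore] -/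
theorem yBit₆_eq (hn : 0 < I.n) (p : ℕ) : yBit₆ g I p = (ovY I).getD p false := by
  have hq₃ : g.q₃ = P₃ I.d := by rw [Geo.q₃, hg.2]
  have hNP : 2 * I.n * g.q₃.γ₃ = g.NP := by unfold Geo.NP; rw [hg.1]; ring
  have hLC := length_coreY_eq g I hg
  unfold yBit₆ threeBit ovY
  rw [← hq₃, g.q₃.getD_gadgetY, hNP, hLC]
  by_cases h1 : p < g.NP
  · rw [if_pos h1, if_pos h1]
  rw [if_neg h1, if_neg h1]
  by_cases h2 : p - g.NP < g.LC
  · rw [if_pos h2, if_pos (by omega), getD_coreY_eq_yBit₅ g I hg hn _ h2]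
  · rw [if_neg h2, if_neg (by omega)]

end bridge

end Literature.Computability.FineGrained.EDRed

namespace Literature.Computability.FineGrained.EDRed

open Cryptography Cryptography.WordRAM Cryptography.WordRAM.SProg BKGadget BKReduction LCSRed

/-! ### The geometry of an instance -/

/-- The geometry of the run on `OV.encode I`. [folklore] -/
noncomputable def geo (I : OVInstance) : Geo := ⟨I.n, I.d, (OV.encode I).length + 100⟩

/-- `geo I` has the right `n`, `d`. [folklore] -/
theorem geo_nd (I : OVInstance) : (geo I).n = I.n ∧ (geo I).d = I.d := ⟨rfl, rfl⟩

/-- `L = |OV.encode I| = 2 + 2 n d`. [folklore] -/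
theorem geo_L (I : OVInstance) : (geo I).L = 2 + 2 * (I.n * I.d) := by
  show (OV.encode I).length + 100 - 100 = _
  rw [length_OV_encode]; omega

/-- `D = |OV.encode I| + 100`. [folklore] -/
theorem geo_D (I : OVInstance) : (geo I).D = 2 + 2 * (I.n * I.d) + 100 := by
  show (OV.encode I).length + 100 = _
  rw [length_OV_encode]

/-! ### The program -/

/-- Output `[0]` (the branch `n = 0`: no vectors, no orthogonal pair). [folklore] -/
def out0 : List OpSpec := [(.add, r 1, im 0, im 0), (.add, r 0, im 1, im 0)]

/-- The read-out after the query: `δ := mem[ANS + 1]` (the edit distance returned by the oracle);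
output `[δ < ρ + 1]`, i.e. `[δ(x, y) ≤ ρ]` (BK15, end of the proof of Thm. 3.3: "`δ(x,y) ≤ ρ` if and
only if there is a pair with `⟨aᵢ, bⱼ⟩ = 0`"). [cite: BringmannKunnemannFOCS2015, Thm. 3.3 (proof, the threshold)] -/
def post : List OpSpec :=
  [(.add, r 20, r 74, im 1), (.add, r 21, pt 20, im 0), (.add, r 23, r 80, im 1),
   (.lt, r 1, r 21, r 23), (.add, r 0, im 1, im 0)]

/-- The main branch: set-up, the two loops, the query, the read-out. [folklore] -/
def main : SProg := seqs [setupMain, loopX, loopY, SProg.query (r 72) (r 73) (r 74), block post]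

/-- **The reduction program** (structured): relocate the input, read `n, d`, branch on `n = 0`.
[cite: BringmannKunnemannFOCS2015, Thm. 3.3 (proof: "x and y … can be constructed in time O((n+m)d)")] -/
def prog : SProg := seq relocate (seq (block setup₁) (ifz (r 10) (block out0) main))

/-- **The reduction program** as a word-RAM oracle program. [folklore] -/
def M : Program := prog.toProgram

/-- The reduction program is deterministic. [folklore] -/
theorem M_isDeterministic : M.IsDeterministic := toProgram_isDeterministic _

/-- The total running time: relocation, set-up, the two loops, the query and the read-out. [folklore] -/
noncomputable def Ttot (I : OVInstance) : ℕ :=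
  7 * (2 + 2 * (I.n * I.d)) + (12 + (2 + (94 + ((geo I).LX * 53 + 1 + (2 + ((geo I).LY * 68 + 1) + (1 + 5)))))) + 2

/-! ### The threshold of the program is `ovThreshold I` -/

/-- `ρ` computed by the set-up is BK15's threshold `C'' + (n-1) ρ₁' + ρ₀'`. [folklore] -/
theorem rho_eq (I : OVInstance) : (geo I).rho = ovThreshold I := by
  have hC₃ : (geo I).C₃ = C₃ I := by
    unfold Geo.C₃ BKReduction.C₃ BKGadget.Params.C Geo.F₃
    have e1 : 4 * (2 * I.n) * (P₃ I.d).γ₂ = (geo I).n * (geo I).q₃.γ₂ * 8 := by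
      show _ = I.n * (P₃ I.d).γ₂ * 8; ring
    have e2 : 4 * (2 * I.n - I.n) * (4 * (P₃ I.d).γ₁ + (P₃ I.d).sx) =
        ((geo I).q₃.γ₁ + (geo I).q₃.γ₁ + ((geo I).q₃.γ₁ + (geo I).q₃.γ₁) + (geo I).q₃.sx) * (geo I).n * 4 := by
      show _ = ((P₃ I.d).γ₁ + (P₃ I.d).γ₁ + ((P₃ I.d).γ₁ + (P₃ I.d).γ₁) + (P₃ I.d).sx) * I.n * 4
      rw [show 2 * I.n - I.n = I.n by omega]; ring
    rw [e1, e2]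
  have hC₂ : (geo I).C₂ = C₂ I.d := by
    unfold Geo.C₂ BKReduction.C₂ BKGadget.Params.C Geo.F₂
    show (P₂ I.d).γ₂ * 8 - ((P₂ I.d).γ₁ + (P₂ I.d).γ₁ + ((P₂ I.d).γ₁ + (P₂ I.d).γ₁) + (P₂ I.d).sx) * 4 = _
    have e1 : 4 * 2 * (P₂ I.d).γ₂ = (P₂ I.d).γ₂ * 8 := by ring
    have e2 : 4 * (2 - 1) * (4 * (P₂ I.d).γ₁ + (P₂ I.d).sx) =
        ((P₂ I.d).γ₁ + (P₂ I.d).γ₁ + ((P₂ I.d).γ₁ + (P₂ I.d).γ₁) + (P₂ I.d).sx) * 4 := by ring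
    rw [e1, e2]
  have hC₁ : (geo I).C₁ = C₁ I.d := by
    unfold Geo.C₁ BKReduction.C₁ BKGadget.Params.C
    show I.d * 9640 + 9640 = _
    rw [P₁_γ₂, Nat.sub_self, Nat.mul_zero, Nat.zero_mul, Nat.sub_zero]; ring
  unfold Geo.rho ovThreshold Geo.rho₀ Geo.rho₁ ρ₀' ρ₁'
  rw [hC₃, hC₂, hC₁]
  show C₃ I + (I.n - 1) * (C₂ I.d + (C₁ I.d + (I.d + I.d + 2 + 2))) + (C₂ I.d + (C₁ I.d + (I.d + I.d + 2))) = _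
  ring

/-! ### The data after the loops, and the query segment -/

section data

variable (I : OVInstance) (hn : 0 < I.n)

/-- The data memory at the time of the query: the relocated input, the header word `LX` at `Q`,
the bits of `ovX I` and `ovY I` after it. [folklore] -/
noncomputable def dataQ : ℕ → ℕ :=
  yData (geo I) I (xData (geo I) I hn (Function.update (relocated (OV.encode I)) (geo I).Q (geo I).LX)
    (geo I).LX) (geo I).LY

/-- **The query segment is `encodeBoolPair (ovX I, ovY I)`.** [folklore] -/
theorem readSeg_dataQ : readSeg (dataQ I hn) (geo I).Q (geo I).LEN = encodeBoolPair (ovX I, ovY I) := by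
  have hLX := length_ovX_eq (geo I) I (geo_nd I) hn
  have hLY := length_ovY_eq (geo I) I (geo_nd I)
  apply readSeg_eq_of_forall (by simp [encodeBoolPair, Geo.LEN, hLX, hLY])
  intro j hj
  unfold Geo.LEN at hj
  simp only [encodeBoolPair]
  rcases Nat.eq_zero_or_pos j with rfl | hjpos
  · -- the header word
    simp only [Nat.add_zero, List.getElem_cons_zero, hLX]
    unfold dataQ yData xData
    rw [if_neg (by omega), if_neg (by omega), Function.update_self]
  · obtain ⟨p, rfl⟩ : ∃ p, j = p + 1 := ⟨j - 1, by omega⟩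
    rw [List.getElem_cons_succ, List.getElem_map]
    unfold dataQ yData xData
    by_cases hpx : p < (geo I).LX
    · -- a bit of `ovX I`
      rw [if_neg (by omega), if_pos ⟨by omega, by omega⟩,
        show (geo I).Q + (p + 1) - ((geo I).Q + 1) = p by omega, xBit₃_eq (geo I) I (geo_nd I) hn p (by omega),
        List.getD_eq_getElem _ _ (by omega), List.getElem_append_left (by omega)]
    · -- a bit of `ovY I`
      rw [if_pos ⟨by omega, by omega⟩, show (geo I).Q + (p + 1) - ((geo I).Q + 1 + (geo I).LX) = p - (geo I).LX by omega,
        yBit₆_eq (geo I) I (geo_nd I) hn, List.getD_eq_getElem _ _ (by omega),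
        List.getElem_append_right (by omega)]
      simp only [hLX]

end data

/-! ### The input bits in the relocated memory -/

section run

variable {W : ℕ} {O : List ℕ → List ℕ} (I : OVInstance)

/-- The bits of `A` in the relocated input. [folklore] -/
theorem relocated_A (i : Fin I.n) (k : Fin I.d) :
    relocated (OV.encode I) ((i : ℕ) * I.d + k + ((geo I).D + 3)) = (I.A i k).toNat := by
  have hlen := length_OV_encode I
  have hik : (i : ℕ) * I.d + k < I.n * I.d :=
    calc (i : ℕ) * I.d + k < i * I.d + I.d := by omega
      _ = (i + 1) * I.d := by ring
      _ ≤ I.n * I.d := Nat.mul_le_mul_right _ i.2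
  rw [show (i : ℕ) * I.d + k + ((geo I).D + 3) = (OV.encode I).length + 100 + (3 + ((i : ℕ) * I.d + k)) by
      rw [geo_D, hlen]; omega,
    relocated_base_add _ (by omega) (by rw [hlen]; omega),
    show 3 + ((i : ℕ) * I.d + k) - 1 = 2 + ((i : ℕ) * I.d + k) by omega, List.getD_eq_getElem?_getD,
    OV_encode_getElem?_A]
  rfl

/-- The bits of `B` in the relocated input. [folklore] -/
theorem relocated_B (j : Fin I.n) (k : Fin I.d) :
    relocated (OV.encode I) ((j : ℕ) * I.d + k + ((geo I).D + 3 + I.n * I.d)) = (I.B j k).toNat := by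
  have hlen := length_OV_encode I
  have hjk : (j : ℕ) * I.d + k < I.n * I.d :=
    calc (j : ℕ) * I.d + k < j * I.d + I.d := by omega
      _ = (j + 1) * I.d := by ring
      _ ≤ I.n * I.d := Nat.mul_le_mul_right _ j.2
  rw [show (j : ℕ) * I.d + k + ((geo I).D + 3 + I.n * I.d) =
      (OV.encode I).length + 100 + (3 + (I.n * I.d + ((j : ℕ) * I.d + k))) by rw [geo_D, hlen]; omega,
    relocated_base_add _ (by omega) (by rw [hlen]; omega),
    show 3 + (I.n * I.d + ((j : ℕ) * I.d + k)) - 1 = 2 + (I.n * I.d + ((j : ℕ) * I.d + k)) by omega,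
    List.getD_eq_getElem?_getD, OV_encode_getElem?_B]
  rfl

/-- `A` is in place for the `x` loop. [folklore] -/
theorem inputA_start :
    InputA (geo I) I (Function.update (relocated (OV.encode I)) (geo I).Q (geo I).LX) := by
  intro i k
  have hik : (i : ℕ) * I.d + k < I.n * I.d :=
    calc (i : ℕ) * I.d + k < i * I.d + I.d := by omega
      _ = (i + 1) * I.d := by ring
      _ ≤ I.n * I.d := Nat.mul_le_mul_right _ i.2
  have hQ : (geo I).Q = (geo I).D + (2 + 2 * (I.n * I.d)) + 1 := by rw [Geo.Q, geo_L]
  rw [Function.update_of_ne (by rw [hQ]; omega)]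
  exact relocated_A I i k

/-- `B` is in place for the `y` loop. [folklore] -/
theorem inputB_start (hn : 0 < I.n) :
    InputB (geo I) I (xData (geo I) I hn (Function.update (relocated (OV.encode I)) (geo I).Q (geo I).LX)
      (geo I).LX) := by
  intro j k
  have hjk : (j : ℕ) * I.d + k < I.n * I.d :=
    calc (j : ℕ) * I.d + k < j * I.d + I.d := by omega
      _ = (j + 1) * I.d := by ring
      _ ≤ I.n * I.d := Nat.mul_le_mul_right _ j.2
  have hQ : (geo I).Q = (geo I).D + (2 + 2 * (I.n * I.d)) + 1 := by rw [Geo.Q, geo_L]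
  unfold xData
  rw [if_neg (by rw [hQ]; omega), Function.update_of_ne (by rw [hQ]; omega)]
  exact relocated_B I j k

/-! ### The run -/

set_option maxHeartbeats 800000 in
/-- **The run of the reduction program.** For every oracle answering `EditDistance`, on
`OV.encode I` the program `prog` executes within `Ttot I` steps to a store whose read-out is `[1]`
iff `I` has an orthogonal pair (`[0]` otherwise) and whose query log is
`[encodeBoolPair (ovX I, ovY I)]` (empty if `n = 0`), provided the word size holds the bound
`(geo I).BND`. The equivalence "`δ(x, y) ≤ ρ` iff an orthogonal pair exists" is
`BKReduction.editDist_ovX_ovY_le_iff` with BK15 Lemma 5.4 proved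
(`alignmentGadget_editDist_holds`). [cite: BringmannKunnemannFOCS2015, Thm. 3.3 (proof) with Lemma 5.4] -/
theorem prog_exec (hB : (geo I).BND < 2 ^ W)
    (hO : EditDistance.OracleAnswers O) :
    ∃ (st : Store) (t : ℕ), t ≤ Ttot I ∧ Exec W O prog ⟨initFun (OV.encode I), []⟩ st t ∧
      readOut st.mem = [if I.HasOrthogonalPair then 1 else 0] ∧
      st.queries = (if I.n = 0 then [] else [encodeBoolPair (ovX I, ovY I)]) := by
  classical
  have hlen : (OV.encode I).length = 2 + 2 * (I.n * I.d) := length_OV_encode I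
  have hDdef : (geo I).D = (OV.encode I).length + 100 := rfl
  have hBND : 10000 * ((geo I).D + (geo I).n + (geo I).d + (geo I).LX + (geo I).LY + (geo I).Q + (geo I).LEN +
      (geo I).rho) + 100000 ≤ (geo I).BND := by unfold Geo.BND; omega
  simp only [(geo_nd I).1, (geo_nd I).2] at hBND
  have hW2 : 2 ≤ 2 ^ W := by omega
  -- the relocation
  have hx : ∀ v ∈ OV.encode I, v < 2 ^ W := fun v hv => by
    have := le_of_mem_OV_encode I hv
    have : max I.n (max I.d 1) ≤ I.n + I.d + 1 := max_le (by omega) (max_le (by omega) (by omega))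
    omega
  have E1 := relocate_exec (w := W) (O := O) (x := OV.encode I) (by omega) hx (by omega) []
  -- chunk 1 of the set-up, from `merge (relocated x) (relocated x)`
  have hself : relocated (OV.encode I) = merge (relocated (OV.encode I)) (relocated (OV.encode I)) :=
    (merge_self _).symm
  have hn_at : relocated (OV.encode I) ((geo I).D + 1) = (geo I).n := by
    rw [hDdef, relocated_base_add _ le_rfl (by omega)]; rfl
  have hd_at : relocated (OV.encode I) ((geo I).D + 2) = (geo I).d := by
    rw [hDdef, relocated_base_add _ (by omega) (by omega)]; rfl
  obtain ⟨m₁, t₁, ht₁, E2, R₁, hm₁, hC₁⟩ := setup₁_spec (O := O) (geo I) (R := relocated (OV.encode I))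
    (H := relocated (OV.encode I)) (by simp [hDdef]) (by simp [hDdef]) (by omega) hn_at hd_at hB []
  rw [← hself] at E2
  have h10 : m₁ 10 = I.n := by rw [hm₁, merge_apply_of_lt (by decide)]; exact hC₁ 10 (by simp)
  by_cases hn0 : I.n = 0
  · -- no vectors: output `[0]`
    have hno : ¬ I.HasOrthogonalPair := fun ⟨i, _, _⟩ => by have := i.isLt; omega
    refine ⟨⟨execOps W m₁ out0, []⟩, _, ?_, Exec.seq E1 (Exec.seq E2 (Exec.ifz_zero (by
      simp only [Operand.read, h10, hn0]) (Exec.block out0 m₁ []))), ?_, by simp [hn0]⟩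
    · show 7 * (OV.encode I).length + (t₁ + (out0.length + 1)) ≤ Ttot I
      simp only [out0, List.length_cons, List.length_nil]
      unfold Ttot; omega
    · rw [if_neg hno]
      have e0 : execOps W m₁ out0 0 = 1 := by
        simp (disch := first | omega | decide) only [out0, execOps_cons, execOps_nil, execOp, Operand.write,
          Operand.read, Function.update_self, BinOp.eval_add_of_lt]
      have e1 : execOps W m₁ out0 1 = 0 := by
        simp (disch := first | omega | decide) only [out0, execOps_cons, execOps_nil, execOp, Operand.write,
          Operand.read, Function.update_self, Function.update_of_ne, BinOp.eval_add_of_lt]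
      simp [readOut, readSeg, e0, e1]
  · -- the main branch
    have hn : 0 < I.n := Nat.pos_of_ne_zero hn0
    have hn' : 1 ≤ (geo I).n := hn
    have hD : 100 ≤ (geo I).D := by rw [hDdef]; omega
    have hL : 2 + 2 * ((geo I).n * (geo I).d) ≤ (geo I).L := by rw [geo_L]; exact le_rfl
    subst hm₁
    -- set-up
    obtain ⟨m₂, t₂, ht₂, E3, R₂, hm₂, hC₂, h3₂, h4₂⟩ := setupMain_spec (O := O) (geo I) (R := R₁)
      (H := relocated (OV.encode I)) hC₁ hD hn' hB []
    subst hm₂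
    -- the `x` loop
    obtain ⟨m₃, t₃, ht₃, E4, R₃, hm₃, hC₃, h3₃, h4₃⟩ := loopX_spec (O := O) (geo I) I (geo_nd I) hC₂ hn
      (inputA_start I) h3₂ h4₂ hL hD hB []
    subst hm₃
    -- the `y` loop
    obtain ⟨m₄, t₄, ht₄, E5, R₄, hm₄, hC₄, h3₄, h4₄⟩ := loopY_spec (O := O) (geo I) I (geo_nd I) hC₃ hn
      (inputB_start I hn) hL hD hB []
    subst hm₄
    -- the query
    have h72 : R₄ 72 = (geo I).Q := hC₄ 72 (by decide)
    have h73 : R₄ 73 = (geo I).LEN := hC₄ 73 (by decide)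
    have h74 : R₄ 74 = (geo I).Q + (geo I).LEN := hC₄ 74 (by decide)
    have hQ100 : 100 ≤ (geo I).Q := by unfold Geo.Q; omega
    have E6 := Exec.query_dir (w := W) (O := O) (qa := 72) (ql := 73) (aa := 74) (by decide) (by decide)
      (by decide) (S := R₄) (by rw [h72]; exact hQ100) (by rw [h74]; omega) (dataQ I hn) []
    rw [h72, h73, h74, List.nil_append, readSeg_dataQ I hn] at E6
    -- the oracle's answer
    have hans : O (encodeBoolPair (ovX I, ovY I)) = [editDist (ovX I) (ovY I)] := by
      have := hO (ovX I, ovY I)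
      simpa [EditDistance, FGProblem.ofFun] using this
    have hedLX : editDist (ovX I) (ovY I) ≤ (geo I).LX + (geo I).LY := by
      have := editDist_le_max_length (ovX I) (ovY I)
      rw [length_ovX_eq (geo I) I (geo_nd I) hn, length_ovY_eq (geo I) I (geo_nd I)] at this
      exact this.trans (max_le (by omega) (by omega))
    have hed : editDist (ovX I) (ovY I) < 2 ^ W := by omega
    rw [hans, List.map_cons, List.map_nil, Nat.mod_eq_of_lt hed] at E6
    -- the read-out
    set H₅ := segWrite (dataQ I hn) ((geo I).Q + (geo I).LEN) [editDist (ovX I) (ovY I)] with hH₅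
    have hval : H₅ ((geo I).Q + (geo I).LEN + 1) = editDist (ovX I) (ovY I) := by
      rw [hH₅]; unfold segWrite
      rw [if_neg (by omega), if_pos ⟨by omega, by simp⟩]
      simp
    have h80 : R₄ 80 = (geo I).rho := hC₄ 80 (by decide)
    have E7 := Exec.block post (W := W) (O := O) (merge R₄ H₅) [encodeBoolPair (ovX I, ovY I)]
    have E8 : Exec W O main ⟨merge R₁ (relocated (OV.encode I)), []⟩
        ⟨execOps W (merge R₄ H₅) post, [encodeBoolPair (ovX I, ovY I)]⟩
        (t₂ + (t₃ + (t₄ + (1 + (post.length + 0))))) :=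
      Exec.seq E3 (Exec.seq E4 (Exec.seq E5 (Exec.seq E6 (Exec.seq E7 (Exec.skip _)))))
    refine ⟨⟨execOps W (merge R₄ H₅) post, [encodeBoolPair (ovX I, ovY I)]⟩, _, ?_,
      Exec.seq E1 (Exec.seq E2 (Exec.ifz_ne (by simp only [Operand.read, h10]; exact hn0) E8)), ?_,
      by simp [hn0]⟩
    · -- the time
      simp only [post, List.length_cons, List.length_nil]
      unfold Ttot; omega
    · -- the read-out is `[δ ≤ ρ]` = `[HasOrthogonalPair]`
      have e0 : execOps W (merge R₄ H₅) post 0 = 1 := by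
        simp (disch := first | omega | decide) only [post, execOps_cons, execOps_nil, execOp, Operand.write,
          Operand.read, merge_apply_of_lt, merge_apply_of_le, update_merge_of_lt, Function.update_self,
          Function.update_of_ne, BinOp.eval_add_of_lt, BinOp.eval_lt, h74, h80, hval]
      have e1 : execOps W (merge R₄ H₅) post 1 =
          if editDist (ovX I) (ovY I) < (geo I).rho + 1 then 1 else 0 := by
        simp (disch := first | omega | decide) only [post, execOps_cons, execOps_nil, execOp, Operand.write,
          Operand.read, merge_apply_of_lt, merge_apply_of_le, update_merge_of_lt, Function.update_self,
          Function.update_of_ne, BinOp.eval_add_of_lt, BinOp.eval_lt, h74, h80, hval, Nat.add_zero]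
      have hflag : (editDist (ovX I) (ovY I) < (geo I).rho + 1) ↔ I.HasOrthogonalPair := by
        rw [← editDist_ovX_ovY_le_iff alignmentGadget_editDist_holds I hn, rho_eq]
        omega
      simp only [readOut, readSeg, e0, List.range_one, List.map_cons, List.map_nil, Nat.add_zero, e1]
      by_cases hp : I.HasOrthogonalPair
      · rw [if_pos (hflag.2 hp), if_pos hp]
      · rw [if_neg (fun h => hp (hflag.1 h)), if_neg hp]

end run

end Literature.Computability.FineGrained.EDRed
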